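import Summits.AnomalousDissipation.AnomalousDissipation.Theorems.BaireTransferRobustLoudUpgradePoly
import Summits.AnomalousDissipation.AnomalousDissipation.Theorems.BaireTransferRobustLoudUpgradeCategory
import Summits.AnomalousDissipation.AnomalousDissipation.Theorems.BaireTransferRobustLoudUpgradeStubFort
import Summits.AnomalousDissipation.AnomalousDissipation.Theorems.BaireTransferRobustLoudUpgradeStubSplitGlue
import Summits.AnomalousDissipation.AnomalousDissipation.Theorems.BaireTransferRobustLoudUpgradeStubSteadyCorrespondenceUhc
import Summits.AnomalousDissipation.AnomalousDissipation.Theorems.BaireTransferRobustLoudUpgradeStubLscInterior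
import Summits.AnomalousDissipation.AnomalousDissipation.Theorems.BaireTransferRobustLoudUpgradeCategorySplit
import Summits.AnomalousDissipation.AnomalousDissipation.Theorems.BaireTransferRobustLoudUpgradeStubDriftStratumClosed
import Summits.AnomalousDissipation.AnomalousDissipation.Theorems.BaireTransferRobustLoudUpgradeStubDriftCorrespondenceUhc
import Summits.AnomalousDissipation.AnomalousDissipation.Theorems.BaireTransferRobustLoudUpgradeStubDriftLscInterior

/-!
# Line `malkin-cone-group-orbits`, skeleton c15 v5 (lead `…-1144-c15-0`) for the crux `BaireTransfer.RobustLoudUpgrade`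
# (stmt-AnomalousDissipation-1144): c14 v4 + THE CATEGORY PACKAGE (waves 1–2 LANDED)

Inherited from c14 (all LANDED): PolyDefs p142960, eight engine stubs, assemblies `…Poly.lean` p145608 and `…SmoothForce.lean` p148755.

c15, wave 1 (LANDED): `Category.stub_steadyStratumClosed` p152681, `Category.stub_fsigma_meagre` p152117, `Category.stub_fort` p152371
(+ `Literature/Topology/FortLowerHemicontinuity.lean` p152691), `Category.stub_splitGlue` p152148; assembly
`Theorems/BaireTransferRobustLoudUpgradeCategory.lean` p153327 (`loudSteadyLeaf` is `F_σ`; `isMeagre_loudSteadyLeaf_diff_interior_loud`: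
the mean-zero steady leaf of the upgrade fails at most on a MEAGRE set, sharp budgets, no stock; registered sub-goal
`steadyLeaf_residual_isMeagre`; dichotomy; door `baireTarget_of_nonmeagre_steadyLeaf`).
c15, wave 2 (LANDED): `Category.stub_steadyCorrespondenceUhc` p153961, `Category.stub_lscInterior` p154073; assembly
`Theorems/BaireTransferRobustLoudUpgradeCategoryGeneric.lean` p154248 (in review: `genericSet S` residual by Fort, GENERIC PERSISTENCE
`mem_interior_loud_of_mem_genericSet`, registered sub-goal `genericSteady_interior`, primed form `interior loudSteadyLeaf ⊆ closure interior loud`,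
meagre steady loudness near a wild force).

Open and crux-EQUIVALENT: `Poly.stub_residual_c14` (`Poly.RobustLoudUpgrade_iff_wild_c14`).  By the category package its MEAN-ZERO STEADY
leaf is meagre for every `S` and avoids the residual set `genericSet S`; what is left at a wild force lives on non-zero-mean steady states
and genuinely time-periodic witnesses of a MEAGRE set of nearby forces' complements — i.e. the census's coincidence set W1, unchanged in kind.

Composition: unchanged — `Poly.RobustLoudUpgrade_of := line_glue_c14 polySteady_subset_closure_interior_loud stub_residual_c14`.
-/

set_option linter.dupNamespace false

noncomputable section

open scoped BigOperators Topology InnerProductSpace RealInnerProductSpace ENNReal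
open Filter Set Function TopologicalSpace MeasureTheory

namespace Summit.AnomalousDissipation.AnomalousDissipation.Theorems.RobustLoudUpgrade

open Literature.Analysis.FunctionSpaces Literature.Analysis.FunctionSpaces.Torus
open Literature.Analysis.FluidPDE
open Summit.AnomalousDissipation.AnomalousDissipation.Theses.BaireTransfer
open Summit.AnomalousDissipation.AnomalousDissipation.Theorems.RobustLoudUpgrade.Unfolding
open Summit.AnomalousDissipation.AnomalousDissipation.Theorems.RobustLoudUpgrade.WildResidual

/-- The flat unit torus `T³`. -/
local notation "𝕋³" => UnitAddTorus (Fin 3)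
/-- Real velocity values. -/
local notation "ℝ³" => EuclideanSpace ℝ (Fin 3)


/-! ## §C (cycle 2) THE ANY-MEAN STEADY LEAF — waves 3–4 ALL LANDED: `stub_driftWeakOfClassical` p155794, `stub_driftLimit` p155099,
`stub_driftRegularity` p155287, `stub_driftClassicalOfWeak` p155846, `stub_driftStratumClosed` p157475, `stub_driftCorrespondenceUhc` p156189,
`stub_driftLscInterior` p157462 (imported above); assemblies `…CategorySplit` p154545 (landed) and `…CategoryDrift` p158016 (in review:
`loudSteadyAll` F_σ, `isMeagre_loudSteadyAll_diff_interior_loud`, `genericSetDrift` residual, generic persistence any mean,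
`residual_decomposition_steadyAll : loud ∖ cl int loud₂ ⊆ (loudSteadyAll ∩ (genericSetDrift S)ᶜ) ∪ (loudCycle ∖ cl int loud₂)`). -/

namespace Poly

/-! ## §1 The one open stub: the wild residual over `tamePoly` (≡ the crux modulo the landed classes) -/

/-- **stub_residual_c14** (the residual of the reshape c14, kept registered by c15; crux-hard — EQUIVALENT to the crux by
`Poly.RobustLoudUpgrade_iff_wild_c14`): for some finite stock `S₀`, in every family `P_S`, `S ⊇ S₀`, at every pair of budgets and every
level, the loud forces that are NOT limits of `tamePoly`-witnessed forces at the relaxed budgets lie in the closure of the robustly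
relaxed-loud forces.  By `Category.isMeagre_steadyLeaf_residual` its mean-zero STEADY part is a meagre set. [folklore] -/
theorem stub_residual_c14 :
    ∃ S₀ : Finset (Fin 3 → ℤ), ∀ S : Finset (Fin 3 → ℤ), S₀ ⊆ S → ∀ (E ε : ℝ), 0 < ε → ∀ j : ℕ,
      loud S (1 / ((j : ℝ) + 1)) E ε \ closure (tamePoly S (1 / ((j : ℝ) + 1)) (2 * E) (ε / 2)) ⊆
        closure (interior (loud S (1 / ((j : ℝ) + 1)) (2 * E) (ε / 2))) := by
  sorry

/-! ## §2 Composition (sorry-free): the crux BY NAME -/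

/-- **Composition (lead c14 v3, kept by c15): the landed class theorem `polySteady_subset_closure_interior_loud` and the registered
residual prove the crux `RobustLoudUpgrade` BY NAME through the landed glue `line_glue_c14`.** [folklore] -/
theorem RobustLoudUpgrade_of : RobustLoudUpgrade :=
  line_glue_c14 polySteady_subset_closure_interior_loud stub_residual_c14

end Poly

end Summit.AnomalousDissipation.AnomalousDissipation.Theorems.RobustLoudUpgrade

end
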